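import Summits.KontsevichZagierPeriods.Zeta5Search.LaiSweepShard

/-!
# `κ₃` sweep certificate — shard file 109 of 127 (shards 763–769 of 889)

HONEST FRAMING. Systematic search; no irrationality claim unless certified. This file only checks,
by `decide +kernel`, shards 763–769 of the order-cell sweep of the `κ₃` point `(74, 2180, 444; δ74)`
(engine `LaiSweepEngine`, soundness `LaiSweepJump/Free/Eval/Shard/Kappa3`; a shard is `⟨regime, n,
p, q, p', q', Lo, Up⟩`: `n` cells from `p/q` to `p'/q'` with integer rate sums in `[Lo, Up]`, `K =
128`, `D = 2^40`). It draws NO conclusion: only the capstone `LaiKappa3SweepCert`, which needs all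
127 shard files, does. Kernel cost of this file ≈ 560 cells × 0.3 s.
-/

namespace Summit.KontsevichZagierPeriods.Zeta5Search.Sweep

set_option maxHeartbeats 100000000 in
/-- Shard 763: 80 cells of regime B from `245/291` to `199/236`.
[cite: Lai2024BallRivoal, §4 Lemma 4.3] -/
theorem shard763 :
    Shard.check 128 (2^40)
      ⟨true, 80, 245, 291, 199, 236, 11167276107808, 17988372461768⟩ = true := by
  decide +kernel

set_option maxHeartbeats 100000000 in
/-- Shard 764: 80 cells of regime B from `199/236` to `4057/4804`.
[cite: Lai2024BallRivoal, §4 Lemma 4.3] -/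
theorem shard764 :
    Shard.check 128 (2^40)
      ⟨true, 80, 199, 236, 4057, 4804, 11056720196498, 17829375587301⟩ = true := by
  decide +kernel

set_option maxHeartbeats 100000000 in
/-- Shard 765: 80 cells of regime B from `4057/4804` to `307/363`.
[cite: Lai2024BallRivoal, §4 Lemma 4.3] -/
theorem shard765 :
    Shard.check 128 (2^40)
      ⟨true, 80, 4057, 4804, 307, 363, 10543207002620, 17019028497020⟩ = true := by
  decide +kernel

set_option maxHeartbeats 100000000 in
/-- Shard 766: 80 cells of regime B from `307/363` to `227/268`.
[cite: Lai2024BallRivoal, §4 Lemma 4.3] -/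
theorem shard766 :
    Shard.check 128 (2^40)
      ⟨true, 80, 307, 363, 227, 268, 11043394187552, 17845382274727⟩ = true := by
  decide +kernel

set_option maxHeartbeats 100000000 in
/-- Shard 767: 80 cells of regime B from `227/268` to `341/402`.
[cite: Lai2024BallRivoal, §4 Lemma 4.3] -/
theorem shard767 :
    Shard.check 128 (2^40)
      ⟨true, 80, 227, 268, 341, 402, 10682134715354, 17279497199809⟩ = true := by
  decide +kernel

set_option maxHeartbeats 100000000 in
/-- Shard 768: 80 cells of regime B from `341/402` to `271/319`.
[cite: Lai2024BallRivoal, §4 Lemma 4.3] -/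
theorem shard768 :
    Shard.check 128 (2^40)
      ⟨true, 80, 341, 402, 271, 319, 10908912995243, 17664821318151⟩ = true := by
  decide +kernel

set_option maxHeartbeats 100000000 in
/-- Shard 769: 80 cells of regime B from `271/319` to `268/315`.
[cite: Lai2024BallRivoal, §4 Lemma 4.3] -/
theorem shard769 :
    Shard.check 128 (2^40)
      ⟨true, 80, 271, 319, 268, 315, 10837572995195, 17567879805644⟩ = true := by
  decide +kernel

/-- The checked shards of this file, in order. [folklore] -/
def shards109 : List (CheckedShard 128 (2^40)) :=
  [⟨_, shard763⟩, ⟨_, shard764⟩, ⟨_, shard765⟩, ⟨_, shard766⟩, ⟨_, shard767⟩,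
    ⟨_, shard768⟩, ⟨_, shard769⟩]

end Summit.KontsevichZagierPeriods.Zeta5Search.Sweep
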